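import Literature.NumberTheory.GaloisCohomology.PoitouTateSelmerStructures
import Summits.BirchSwinnertonDyer.Rank1Residual.X11b.PerfectPairingAnnihilators
import HarnessLib

/-!
# X11b, route R1 — the COUNTING form of Poitou–Tate duality for Selmer structures at one place:
# `[H¹_𝓖(K,M) : H¹_𝓕(K,M)] · [H¹_{𝓕^*}(K,M^D) : H¹_{𝓖^*}(K,M^D)] = [𝓖_{v₀} : 𝓕_{v₀}]`

HONEST FRAMING (cell `b2b-bsdres`, run/shared/lean/b2b/bsd-rank1-residual/, verbatim in every
file): the goal of the cell is to DELETE the COMBINATION-SHAPED residual classes of the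
Birch–Swinnerton-Dyer formula for ALL analytic-rank `≤ 1` elliptic curves over `ℚ` — "full BSD
formula for every rank `≤ 1` curve in class `C`" assembled STRICTLY from published theorems — so
that the rank-`≤ 1` remainder becomes exactly the CONSTRUCTION-SHAPED classes, which are TYPED
(missing-input `Prop`s), NOT attempted. This is not "finishing BSD". Sub-cell
`b2b-bsdres-multr1-p1` (X11b, route R1 = Castella 2018 Thm. A re-proved along the author's
erratum); a RESEARCH ROUTE; no claim beyond the stated class; X11b stays CONSTRUCTION-SHAPED;
nothing here changes a label; no named fact is minted (theorems only; the Poitou–Tate input is the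
tree's named fact `poitouTate_selmerStructure_duality`, taken as a hypothesis on the family of
local invariant maps; no `sorry`).

## What this file proves

For a family `inv` of local invariant maps with the properties of the named fact (`IsPerfect`,
`SumLocalTermEqZero`, `SelmerComplement`; file
`Literature/NumberTheory/GaloisCohomology/PoitouTateSelmerStructures.lean`), a finite discrete
`Γ_K`-module `M` killed by `n`, a finite set of places `S ⊇ {v ∣ ∞} ∪ {v ∣ n} ∪ Ram(M)`, Selmer
structures `𝓕 ≤ 𝓖` unramified outside `S` which DIFFER ONLY AT ONE FINITE PLACE `v₀ ∈ S` — the shape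
of every use of global duality in Jetchev–Skinner–Wan 2017, Prop. 3.2.1 (`𝓕_v ≤ 𝓕`, `𝓕_v ≤ 𝓕_ac`
differing at `v`, resp. `v̄`) —

* `sup_map_selmerGroup_eq_annLeft`: **`loc_{v₀}(H¹_𝓖(K, M)) + 𝓕_{v₀}` is the exact left annihilator
  of `loc_{v₀}(H¹_{𝓕^*}(K, M^D)) + 𝓖^*_{v₀}`** under `⟨·, ·⟩_{v₀}` (Howard Thm. 2.1.11 at one place, as
  an identity of subgroups of `H¹(K_{v₀}, M)`: `⊆` from the Poitou–Tate vanishing, `⊇` from the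
  `SelmerComplement` clause with `t` supported at `v₀` and the double annihilator `{}^⊥(𝓖^*) = 𝓖`);
* `relIndex_selmerGroup_eq` : `[H¹_𝓖 : H¹_𝓕] = [loc(H¹_𝓖) + 𝓕_{v₀} : 𝓕_{v₀}]` (`H¹_𝓕 = H¹_𝓖 ∩ loc⁻¹𝓕_{v₀}`);
* **`relIndex_selmerGroup_mul_relIndex_dual_eq`:
  `[H¹_𝓖(K, M) : H¹_𝓕(K, M)] · [H¹_{𝓕^*}(K, M^D) : H¹_{𝓖^*}(K, M^D)] = [𝓖_{v₀} : 𝓕_{v₀}]`** — the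
  counting form ("`#im(α) = #coker(β)`", JSW17 p. 10) by `natCard_mul_natCard_eq_of_eq_annLeft`
  (`PerfectPairingAnnihilators.lean`).

Corollaries: `[H¹_𝓖 : H¹_𝓕] ∣ [𝓖_{v₀} : 𝓕_{v₀}]`; `[H¹_𝓖 : H¹_𝓕] = [𝓖_{v₀} : 𝓕_{v₀}]` iff the dual
Selmer groups agree (`relIndex_selmerGroup_eq_iff_dual`), refining (A)/(B) of the Literature file
to a count.  Everything at finite level (`M` finite); the `T`/`W` limits are not here.

References: [Howard2004HeegnerKolyvagin] Thm. 2.1.11; [JetchevSkinnerWan2017] Prop. 3.2.1 proof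
(arXiv:1512.06894 p. 10); [MilneADT2006] I Cor. 2.3, Thm. 4.10.
-/

noncomputable section

open Function NumberField IsDedekindDomain
open scoped NumberField

universe u

namespace Summit.BirchSwinnertonDyer.Rank1Residual.X11b.PoitouTateCounting

open Literature.NumberTheory.GaloisRepresentations
open Literature.NumberTheory.GaloisRepresentations.DiscreteGaloisModule (localTatePairingZMod
  tateDual SelmerStructure)
open Literature.NumberTheory.GaloisCohomology
open Literature.NumberTheory.GaloisCohomology.LocalInvariants
open Summit.BirchSwinnertonDyer.Rank1Residual.X11b.FiniteDuality

variable {K : Type u} [Field K] [NumberField K] {n : ℕ} {M : Type u} [AddCommGroup M]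
  [TopologicalSpace M] [DiscreteTopology M]

/-! ## The dual local condition is the right annihilator under `⟨·, ·⟩_v` -/

/-- `𝓛_v^*` (`LocalInvariants.dualLocalCondition`) is the right annihilator `annRight` of `𝓛_v` for
the pairing `⟨·, ·⟩_v = inv_v(· ∪ ·)` (definitionally). [folklore] -/
theorem dualLocalCondition_eq_annRight [Finite M] (inv : LocalInvariants K n)
    (ρ : DiscreteGaloisModule K M)
    (v : Place K) (L : AddSubgroup (galoisCohomology (ρ.toLocal v) 1)) :
    inv.dualLocalCondition ρ v L = annRight (localTatePairingZMod ρ n v (inv v)) L :=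
  SetLike.ext fun _ => Iff.rfl

/-- **The dual of the relaxed condition is the strict condition** at a finite place `w`:
`(H¹(K_w, M))^* = 0`, by local Tate duality for the family (`IsPerfect`: the adjoint
`H¹(K_w, M^D) → Hom(H¹(K_w, M), ℤ/n)` is injective).  With `dualLocalCondition_bot` (`0^* = ⊤`) and
`UnramifiedOrthogonal` (`H¹_ur^* = H¹_ur`) this computes the dual of every local condition used by
the anticyclotomic Selmer structures (strict / relaxed / unramified; Howard Def. 2.1.1).
[cite: Howard2004HeegnerKolyvagin, Def. 2.1.1 and Def. 2.1.6 (arXiv:1202.6340 p. 5)] -/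
theorem dualLocalCondition_top [Finite M] [NeZero n] {inv : LocalInvariants K n}
    (hperf : inv.IsPerfect) (ρ : DiscreteGaloisModule K M) (hM : ∀ m : M, n • m = 0)
    (w : HeightOneSpectrum (𝓞 K)) :
    inv.dualLocalCondition ρ (Sum.inr w) ⊤ = ⊥ := by
  rw [eq_bot_iff]
  intro y hy
  rw [AddSubgroup.mem_bot]
  refine ((hperf w).2 ρ hM).2.1 (AddMonoidHom.ext fun a => ?_)
  rw [map_zero, AddMonoidHom.zero_apply, AddMonoidHom.flip_apply]
  exact hy a (AddSubgroup.mem_top a)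

/-! ## A Selmer structure and a coarsening differing at one place -/

section OnePlace

variable {ρ : DiscreteGaloisModule K M} {𝓕 𝓖 : SelmerStructure ρ} {v₀ : Place K}

/-- If `𝓕 ≤ 𝓖` agree away from `v₀` then `H¹_𝓕(K, M) = H¹_𝓖(K, M) ∩ loc_{v₀}⁻¹(𝓕_{v₀})` (exactness of
Howard's first sequence on the left). [folklore] -/
theorem selmerGroup_eq_inf_comap (hle : 𝓕 ≤ 𝓖) (heq : ∀ v ≠ v₀, 𝓕 v = 𝓖 v) :
    𝓕.selmerGroup = 𝓖.selmerGroup ⊓ (𝓕 v₀).comap (galoisCohomology.localization ρ v₀ 1) := by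
  ext c
  simp only [AddSubgroup.mem_inf, AddSubgroup.mem_comap, SelmerStructure.mem_selmerGroup_iff]
  constructor
  · exact fun h => ⟨fun v => hle v (h v), h v₀⟩
  · rintro ⟨h, h₀⟩ v
    by_cases hv : v = v₀
    · subst hv; exact h₀
    · rw [heq v hv]; exact h v

/-- **`[H¹_𝓖 : H¹_𝓕] = [loc_{v₀}(H¹_𝓖) + 𝓕_{v₀} : 𝓕_{v₀}]`**: the image of Howard's first localisation
map `H¹_𝓖(K, M)/H¹_𝓕(K, M) ↪ 𝓖_{v₀}/𝓕_{v₀}` has order `[loc(H¹_𝓖) ⊔ 𝓕_{v₀} : 𝓕_{v₀}]` (second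
isomorphism theorem, via Mathlib's `relIndex_comap`, `relIndex_sup_right`). [folklore] -/
theorem relIndex_selmerGroup_eq (hle : 𝓕 ≤ 𝓖) (heq : ∀ v ≠ v₀, 𝓕 v = 𝓖 v) :
    𝓕.selmerGroup.relIndex 𝓖.selmerGroup =
      (𝓕 v₀).relIndex
        (𝓖.selmerGroup.map (galoisCohomology.localization ρ v₀ 1) ⊔ 𝓕 v₀) := by
  rw [selmerGroup_eq_inf_comap hle heq, inf_comm, AddSubgroup.inf_relIndex_right,
    AddSubgroup.relIndex_comap, AddSubgroup.relIndex_sup_right]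

end OnePlace

/-! ## Howard Thm. 2.1.11 at one place, as an identity of subgroups, and its counting form -/

section Main

variable [Finite M] {inv : LocalInvariants K n} {ρ : DiscreteGaloisModule K M}
  {S : Finset (Place K)} {𝓕 𝓖 : SelmerStructure ρ} {w₀ : HeightOneSpectrum (𝓞 K)}

/-- **Exact orthogonal complements at one place (Howard 2004 Thm. 2.1.11 ⟸ `SelmerComplement` +
Poitou–Tate vanishing + local duality).**  If `𝓕 ≤ 𝓖` are Selmer structures unramified outside
`S ⊇ {v ∣ ∞} ∪ {v ∣ n} ∪ Ram(M)` agreeing away from the finite place `v₀ = w₀ ∈ S`, then inside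
`H¹(K_{v₀}, M)`

  `loc_{v₀}(H¹_𝓖(K, M)) + 𝓕_{v₀} = {}^⊥( loc_{v₀}(H¹_{𝓕^*}(K, M^D)) + 𝓖^*_{v₀} )`.

`⊆`: a Selmer class of `𝓖` pairs to zero with a dual Selmer class of `𝓕^*` at `v₀` because the local
terms elsewhere vanish (`SumLocalTermEqZero.sum_localTerm_selmer_eq_zero` with `S = {v₀}`), and
`⟨𝓖_{v₀}, 𝓖^*_{v₀}⟩ = 0`, `⟨𝓕_{v₀}, 𝓕^*_{v₀}⟩ = 0`; `⊇`: an element of the annihilator lies in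
`{}^⊥(𝓖^*_{v₀}) = 𝓖_{v₀}` (`annLeft_annRight`) and is annihilated by `loc(H¹_{𝓕^*})`, so
`SelmerComplement` (with `t` supported at `v₀`) produces the Selmer class.
[cite: Howard2004HeegnerKolyvagin, Thm. 2.1.11 (arXiv:1202.6340 p. 6)] -/
theorem sup_map_selmerGroup_eq_annLeft [NeZero n] (hperf : inv.IsPerfect)
    (hvan : inv.SumLocalTermEqZero) (hcomp : inv.SelmerComplement) (hM : ∀ m : M, n • m = 0)
    (hS : ∀ v : HeightOneSpectrum (𝓞 K), (Sum.inr v : Place K) ∉ S →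
      ((n : ℕ) : 𝓞 K) ∉ v.asIdeal ∧ GaloisRep.IsUnramifiedAt v ρ)
    (hle : 𝓕 ≤ 𝓖) (h𝓕 : 𝓕.IsUnramifiedOutside S) (h𝓖 : 𝓖.IsUnramifiedOutside S)
    (hw₀ : (Sum.inr w₀ : Place K) ∈ S) (heq : ∀ v ≠ (Sum.inr w₀ : Place K), 𝓕 v = 𝓖 v) :
    𝓖.selmerGroup.map (galoisCohomology.localization ρ (Sum.inr w₀) 1) ⊔ 𝓕 (Sum.inr w₀) =
      annLeft (localTatePairingZMod ρ n (Sum.inr w₀) (inv (Sum.inr w₀)))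
        ((inv.dualSelmerStructure ρ 𝓕).selmerGroup.map
            (galoisCohomology.localization (ρ.tateDual n) (Sum.inr w₀) 1) ⊔
          inv.dualSelmerStructure ρ 𝓖 (Sum.inr w₀)) := by
  classical
  set v₀ : Place K := Sum.inr w₀ with hv₀
  set b := localTatePairingZMod ρ n v₀ (inv v₀) with hb
  haveI : Finite (galoisCohomology (ρ.toLocal v₀) 1) := finite_galoisCohomology_one_toLocal ρ w₀
  haveI : Finite (galoisCohomology ((ρ.tateDual n).toLocal v₀) 1) :=
    finite_galoisCohomology_one_tateDual_toLocal ρ n w₀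
  have hA : ∀ a : galoisCohomology (ρ.toLocal v₀) 1, n • a = 0 :=
    galoisCohomology.nsmul_eq_zero_of_forall (ρ.toLocal v₀) hM
  have hB : ∀ y : galoisCohomology ((ρ.tateDual n).toLocal v₀) 1, n • y = 0 :=
    galoisCohomology.nsmul_eq_zero_of_forall _ fun f => DiscreteGaloisModule.TateDual.nsmul_eq_zero f
  have hbij : Bijective b ∧ Bijective b.flip := (hperf w₀).2 ρ hM
  refine le_antisymm ?_ ?_
  · -- `⊆`: both summands pair to zero with both summands
    rw [annLeft_sup, le_inf_iff]
    refine ⟨sup_le ?_ ?_, sup_le ?_ ?_⟩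
    · -- loc(Sel_𝓖) ⟂ loc(Sel_{𝓕^*}) : Poitou–Tate vanishing with `S = {v₀}`
      rintro _ ⟨x, hx, rfl⟩ _ ⟨y, hy, rfl⟩
      have hout : ∀ v ∉ ({v₀} : Finset (Place K)), 𝓖 v ≤ 𝓕 v := fun v hv =>
        (heq v (by simpa using hv)).symm.le
      have := hvan.sum_localTerm_selmer_eq_zero ρ hM (S := {v₀}) hout hx hy
      rw [Finset.sum_singleton, localTerm_apply] at this
      simpa [hb] using this
    · -- 𝓕_{v₀} ⟂ loc(Sel_{𝓕^*}) : Selmer condition of `𝓕^*` at `v₀`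
      rintro a ha _ ⟨y, hy, rfl⟩
      rw [SetLike.mem_coe, SelmerStructure.mem_selmerGroup_iff] at hy
      exact hy v₀ a ha
    · -- loc(Sel_𝓖) ⟂ 𝓖^*_{v₀} : Selmer condition of `𝓖` at `v₀`
      rintro _ ⟨x, hx, rfl⟩ y hy
      rw [SetLike.mem_coe, SelmerStructure.mem_selmerGroup_iff] at hx
      exact hy _ (hx v₀)
    · -- 𝓕_{v₀} ⟂ 𝓖^*_{v₀} ≤ 𝓕^*_{v₀}
      intro a ha y hy
      exact (inv.dualSelmerStructure_anti ρ hle v₀ hy) a ha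
  · -- `⊇`: annihilator elements come from Selmer classes (SelmerComplement at the one place)
    intro a ha
    rw [annLeft_sup, AddSubgroup.mem_inf] at ha
    obtain ⟨ha₁, ha₂⟩ := ha
    -- `a ∈ {}^⊥(𝓖^*_{v₀}) = 𝓖_{v₀}`
    have haG : a ∈ 𝓖 v₀ := by
      have h := annLeft_annRight hA hB b hbij.1 hbij.2 (𝓖 v₀)
      rw [← h]
      rw [dualSelmerStructure_apply, dualLocalCondition_eq_annRight] at ha₂
      exact ha₂
    -- the annihilation hypothesis of `SelmerComplement` (i) for `t = single v₀ a`
    obtain ⟨x, hx, hxa, -⟩ :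
        ∃ x ∈ 𝓖.selmerGroup, galoisCohomology.localization ρ v₀ 1 x - a ∈ 𝓕 v₀ ∧
          ∀ v ∈ S, v ≠ v₀ → galoisCohomology.localization ρ v 1 x ∈ 𝓕 v := by
      set t : Π v : Place K, galoisCohomology (ρ.toLocal v) 1 := Pi.single v₀ a with ht_def
      have ht : ∀ v ∈ S, t v ∈ 𝓖 v := fun v _ => by
        by_cases hv : v = v₀
        · subst hv; rw [ht_def, Pi.single_eq_same]; exact haG
        · rw [ht_def, Pi.single_eq_of_ne hv]; exact zero_mem _
      have hann : ∀ y ∈ (inv.dualSelmerStructure ρ 𝓕).selmerGroup,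
          ∑ v ∈ S, localTatePairingZMod ρ n v (inv v) (t v)
            (galoisCohomology.localization (ρ.tateDual n) v 1 y) = 0 := fun y hy => by
        have hsum : ∑ v ∈ S, localTatePairingZMod ρ n v (inv v) (t v)
            (galoisCohomology.localization (ρ.tateDual n) v 1 y) =
            localTatePairingZMod ρ n v₀ (inv v₀) (t v₀)
              (galoisCohomology.localization (ρ.tateDual n) v₀ 1 y) :=
          Finset.sum_eq_single_of_mem v₀ hw₀ fun v _ hv => by
            rw [ht_def, Pi.single_eq_of_ne hv, map_zero, AddMonoidHom.zero_apply]
        rw [hsum, ht_def, Pi.single_eq_same]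
        exact ha₁ _ ⟨y, hy, rfl⟩
      obtain ⟨x, hx, hxt⟩ := (hcomp ρ hM S hS 𝓕 𝓖 hle h𝓕 h𝓖).1 t ht hann
      refine ⟨x, hx, ?_, fun v hv hne => ?_⟩
      · have := hxt v₀ hw₀
        rwa [ht_def, Pi.single_eq_same] at this
      · have := hxt v hv
        rwa [ht_def, Pi.single_eq_of_ne hne, sub_zero] at this
    -- `a = loc x - (loc x - a)`
    have : a = galoisCohomology.localization ρ v₀ 1 x - (galoisCohomology.localization ρ v₀ 1 x - a) := by
      abel
    rw [this]
    exact AddSubgroup.sub_mem _ (AddSubgroup.mem_sup_left ⟨x, hx, rfl⟩) (AddSubgroup.mem_sup_right hxa)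

/-- **The counting form of Poitou–Tate duality for Selmer structures at one place**:
`[H¹_𝓖(K, M) : H¹_𝓕(K, M)] · [H¹_{𝓕^*}(K, M^D) : H¹_{𝓖^*}(K, M^D)] = [𝓖_{v₀} : 𝓕_{v₀}]`
for Selmer structures `𝓕 ≤ 𝓖` (unramified outside `S ⊇ {v ∣ ∞} ∪ {v ∣ n} ∪ Ram(M)`) differing only
at the finite place `v₀ ∈ S` — "`#H¹_ac(K, W) = #ker(α) · #im(α) = #ker(α) · #coker(β)`, where the
second equality follows from Theorem 2.3.4" (Jetchev–Skinner–Wan 2017, proof of Prop. 3.2.1).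
From `sup_map_selmerGroup_eq_annLeft` by the annihilator count
`natCard_mul_natCard_eq_of_eq_annLeft` and `#𝓛_v · #𝓛_v^* = #H¹(K_v, M^D)`.
[cite: JetchevSkinnerWan2017, Prop. 3.2.1 proof (arXiv:1512.06894 p. 10)]
[cite: Howard2004HeegnerKolyvagin, Thm. 2.1.11 (arXiv:1202.6340 p. 6)] -/
theorem relIndex_selmerGroup_mul_relIndex_dual_eq [NeZero n] (hperf : inv.IsPerfect)
    (hvan : inv.SumLocalTermEqZero) (hcomp : inv.SelmerComplement) (hM : ∀ m : M, n • m = 0)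
    (hS : ∀ v : HeightOneSpectrum (𝓞 K), (Sum.inr v : Place K) ∉ S →
      ((n : ℕ) : 𝓞 K) ∉ v.asIdeal ∧ GaloisRep.IsUnramifiedAt v ρ)
    (hle : 𝓕 ≤ 𝓖) (h𝓕 : 𝓕.IsUnramifiedOutside S) (h𝓖 : 𝓖.IsUnramifiedOutside S)
    (hw₀ : (Sum.inr w₀ : Place K) ∈ S) (heq : ∀ v ≠ (Sum.inr w₀ : Place K), 𝓕 v = 𝓖 v) :
    𝓕.selmerGroup.relIndex 𝓖.selmerGroup *
        (inv.dualSelmerStructure ρ 𝓖).selmerGroup.relIndex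
          (inv.dualSelmerStructure ρ 𝓕).selmerGroup =
      (𝓕 (Sum.inr w₀)).relIndex (𝓖 (Sum.inr w₀)) := by
  classical
  set v₀ : Place K := Sum.inr w₀ with hv₀
  set b := localTatePairingZMod ρ n v₀ (inv v₀) with hb
  haveI : Finite (galoisCohomology (ρ.toLocal v₀) 1) := finite_galoisCohomology_one_toLocal ρ w₀
  haveI : Finite (galoisCohomology ((ρ.tateDual n).toLocal v₀) 1) :=
    finite_galoisCohomology_one_tateDual_toLocal ρ n w₀
  have hA : ∀ a : galoisCohomology (ρ.toLocal v₀) 1, n • a = 0 :=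
    galoisCohomology.nsmul_eq_zero_of_forall (ρ.toLocal v₀) hM
  have hB : ∀ y : galoisCohomology ((ρ.tateDual n).toLocal v₀) 1, n • y = 0 :=
    galoisCohomology.nsmul_eq_zero_of_forall _ fun f => DiscreteGaloisModule.TateDual.nsmul_eq_zero f
  have hbij : Bijective b ∧ Bijective b.flip := (hperf w₀).2 ρ hM
  -- the two big subgroups `X ≤ H¹(K_{v₀}, M)`, `Y ≤ H¹(K_{v₀}, M^D)`
  set X := 𝓖.selmerGroup.map (galoisCohomology.localization ρ v₀ 1) ⊔ 𝓕 v₀ with hX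
  set Y := (inv.dualSelmerStructure ρ 𝓕).selmerGroup.map
      (galoisCohomology.localization (ρ.tateDual n) v₀ 1) ⊔ inv.dualSelmerStructure ρ 𝓖 v₀ with hY
  have hXY : X = annLeft b Y :=
    sup_map_selmerGroup_eq_annLeft hperf hvan hcomp hM hS hle h𝓕 h𝓖 hw₀ heq
  -- indices as quotients of cardinalities
  have h1 : 𝓕.selmerGroup.relIndex 𝓖.selmerGroup = (𝓕 v₀).relIndex X :=
    relIndex_selmerGroup_eq hle heq
  have hle' : inv.dualSelmerStructure ρ 𝓖 ≤ inv.dualSelmerStructure ρ 𝓕 :=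
    inv.dualSelmerStructure_anti ρ hle
  have heq' : ∀ v ≠ v₀, inv.dualSelmerStructure ρ 𝓖 v = inv.dualSelmerStructure ρ 𝓕 v :=
    fun v hv => by rw [dualSelmerStructure_apply, dualSelmerStructure_apply, heq v hv]
  have h2 : (inv.dualSelmerStructure ρ 𝓖).selmerGroup.relIndex
      (inv.dualSelmerStructure ρ 𝓕).selmerGroup = (inv.dualSelmerStructure ρ 𝓖 v₀).relIndex Y :=
    relIndex_selmerGroup_eq hle' heq'
  rw [h1, h2]
  -- cardinalities
  have cXY : Nat.card X * Nat.card Y = Nat.card (galoisCohomology (ρ.toLocal v₀) 1) :=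
    natCard_mul_natCard_eq_of_eq_annLeft hB b hbij.1 hXY
  have cF : Nat.card (𝓕 v₀) * (𝓕 v₀).relIndex X = Nat.card X :=
    natCard_mul_relIndex_of_le le_sup_right
  have cG' : Nat.card (inv.dualSelmerStructure ρ 𝓖 v₀) *
      (inv.dualSelmerStructure ρ 𝓖 v₀).relIndex Y = Nat.card Y :=
    natCard_mul_relIndex_of_le le_sup_right
  have cFG : Nat.card (𝓕 v₀) * (𝓕 v₀).relIndex (𝓖 v₀) = Nat.card (𝓖 v₀) :=
    natCard_mul_relIndex_of_le (hle v₀)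
  have cGdual : Nat.card (inv.dualSelmerStructure ρ 𝓖 v₀) * Nat.card (𝓖 v₀) =
      Nat.card (galoisCohomology ((ρ.tateDual n).toLocal v₀) 1) := by
    rw [dualSelmerStructure_apply, dualLocalCondition_eq_annRight]
    exact natCard_annRight_mul hA b hbij.2 (𝓖 v₀)
  have cAB : Nat.card (galoisCohomology (ρ.toLocal v₀) 1) =
      Nat.card (galoisCohomology ((ρ.tateDual n).toLocal v₀) 1) :=
    natCard_eq_of_bijective hB b hbij.1
  have hposF : 0 < Nat.card (𝓕 v₀) := Nat.card_pos
  have hposG' : 0 < Nat.card (inv.dualSelmerStructure ρ 𝓖 v₀) := Nat.card_pos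
  -- `#F·r₁ · #G*·r₂ = #X·#Y = #A = #B = #G*·#G = #G*·#F·r`
  refine Nat.eq_of_mul_eq_mul_left (Nat.mul_pos hposF hposG') ?_
  calc Nat.card (𝓕 v₀) * Nat.card (inv.dualSelmerStructure ρ 𝓖 v₀) *
        ((𝓕 v₀).relIndex X * (inv.dualSelmerStructure ρ 𝓖 v₀).relIndex Y)
      = (Nat.card (𝓕 v₀) * (𝓕 v₀).relIndex X) *
          (Nat.card (inv.dualSelmerStructure ρ 𝓖 v₀) *
            (inv.dualSelmerStructure ρ 𝓖 v₀).relIndex Y) := by ring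
    _ = Nat.card X * Nat.card Y := by rw [cF, cG']
    _ = Nat.card (galoisCohomology ((ρ.tateDual n).toLocal v₀) 1) := by rw [cXY, cAB]
    _ = Nat.card (inv.dualSelmerStructure ρ 𝓖 v₀) * Nat.card (𝓖 v₀) := cGdual.symm
    _ = Nat.card (inv.dualSelmerStructure ρ 𝓖 v₀) * (Nat.card (𝓕 v₀) * (𝓕 v₀).relIndex (𝓖 v₀)) := by
          rw [cFG]
    _ = Nat.card (𝓕 v₀) * Nat.card (inv.dualSelmerStructure ρ 𝓖 v₀) *
          (𝓕 v₀).relIndex (𝓖 v₀) := by ring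

/-- **Corollary: `[H¹_𝓖(K, M) : H¹_𝓕(K, M)]` divides `[𝓖_{v₀} : 𝓕_{v₀}]`**, the cofactor being the
index of the dual Selmer groups. [cite: Howard2004HeegnerKolyvagin, Thm. 2.1.11 (arXiv:1202.6340 p. 6)] -/
theorem relIndex_selmerGroup_dvd [NeZero n] (hperf : inv.IsPerfect)
    (hvan : inv.SumLocalTermEqZero) (hcomp : inv.SelmerComplement) (hM : ∀ m : M, n • m = 0)
    (hS : ∀ v : HeightOneSpectrum (𝓞 K), (Sum.inr v : Place K) ∉ S →
      ((n : ℕ) : 𝓞 K) ∉ v.asIdeal ∧ GaloisRep.IsUnramifiedAt v ρ)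
    (hle : 𝓕 ≤ 𝓖) (h𝓕 : 𝓕.IsUnramifiedOutside S) (h𝓖 : 𝓖.IsUnramifiedOutside S)
    (hw₀ : (Sum.inr w₀ : Place K) ∈ S) (heq : ∀ v ≠ (Sum.inr w₀ : Place K), 𝓕 v = 𝓖 v) :
    𝓕.selmerGroup.relIndex 𝓖.selmerGroup ∣ (𝓕 (Sum.inr w₀)).relIndex (𝓖 (Sum.inr w₀)) :=
  Dvd.intro _ (relIndex_selmerGroup_mul_relIndex_dual_eq hperf hvan hcomp hM hS hle h𝓕 h𝓖 hw₀ heq)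

/-- **Corollary: `[H¹_𝓖 : H¹_𝓕] = [𝓖_{v₀} : 𝓕_{v₀}]` (i.e. `loc_{v₀} : H¹_𝓖/H¹_𝓕 → 𝓖_{v₀}/𝓕_{v₀}` is onto)
iff `H¹_{𝓕^*}(K, M^D) = H¹_{𝓖^*}(K, M^D)`** — (A) and (B) of `PoitouTateSelmerStructures.lean` as one
count (`relIndex = 1 ↔ ≤`). [cite: JetchevSkinnerWan2017, Prop. 3.2.1 and Prop. 3.3.2 (arXiv:1512.06894 pp. 10–11)] -/
theorem relIndex_selmerGroup_eq_iff_dual [NeZero n] (hperf : inv.IsPerfect)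
    (hvan : inv.SumLocalTermEqZero) (hcomp : inv.SelmerComplement) (hM : ∀ m : M, n • m = 0)
    (hS : ∀ v : HeightOneSpectrum (𝓞 K), (Sum.inr v : Place K) ∉ S →
      ((n : ℕ) : 𝓞 K) ∉ v.asIdeal ∧ GaloisRep.IsUnramifiedAt v ρ)
    (hle : 𝓕 ≤ 𝓖) (h𝓕 : 𝓕.IsUnramifiedOutside S) (h𝓖 : 𝓖.IsUnramifiedOutside S)
    (hw₀ : (Sum.inr w₀ : Place K) ∈ S) (heq : ∀ v ≠ (Sum.inr w₀ : Place K), 𝓕 v = 𝓖 v) :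
    𝓕.selmerGroup.relIndex 𝓖.selmerGroup = (𝓕 (Sum.inr w₀)).relIndex (𝓖 (Sum.inr w₀)) ↔
      (inv.dualSelmerStructure ρ 𝓕).selmerGroup ≤ (inv.dualSelmerStructure ρ 𝓖).selmerGroup := by
  have h := relIndex_selmerGroup_mul_relIndex_dual_eq hperf hvan hcomp hM hS hle h𝓕 h𝓖 hw₀ heq
  -- `[𝓖_{v₀} : 𝓕_{v₀}] ≠ 0` in the finite group `H¹(K_{v₀}, M)`
  have hr : (𝓕 (Sum.inr w₀)).relIndex (𝓖 (Sum.inr w₀)) ≠ 0 := by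
    haveI : Finite (galoisCohomology (ρ.toLocal (Sum.inr w₀)) 1) :=
      finite_galoisCohomology_one_toLocal ρ w₀
    rw [AddSubgroup.relIndex]
    exact AddSubgroup.index_ne_zero_of_finite
  rw [← AddSubgroup.relIndex_eq_one]
  constructor
  · intro heq1
    rw [heq1] at h
    exact (mul_eq_left₀ hr).mp h
  · intro h1
    rwa [h1, mul_one] at h

end Main

end Summit.BirchSwinnertonDyer.Rank1Residual.X11b.PoitouTateCounting

end
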